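import Literature.NumberTheory.EllipticCurves.BSDSelmerPConverse
import HarnessLib

/-!
# BSD family — the rank-one `p`-converse over the Heegner field under (irr)
# (Burungale–Castella–Grossi–Skinner 2026, Thm. 1 + Cor. 1; named fact)

Topic `Literature/NumberTheory/EllipticCurves`.  ONE named fact, no proofs.

A. Burungale, F. Castella, G. Grossi, C. Skinner, *Non-vanishing of Kolyvagin systems and Iwasawa
theory*, Camb. J. Math. 14 (2026) 285–348 (= arXiv:2312.09301), §0.1: **Theorem 1** (non-vanishing
of the Heegner-point Kolyvagin system) — `E/ℚ` an elliptic curve, `p` an odd prime of good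
ordinary reduction, `K` an imaginary quadratic field with (Heeg) every prime `ℓ ∣ N` splits in
`K`, (disc) `D_K` odd and `D_K ≠ -3`, (tor) `E(K)[p] = 0`, and `p` split in `K`, under the rational
anticyclotomic Iwasawa-theoretic divisibility hypothesis of their §0.1 — a THEOREM "in
particular" when `p > 3` satisfies (irr) `E[p]` irreducible (Burungale–Castella–Skinner,
IMRN 2025, Thm. 1.2.2 (a)), which is the only case stated here — the system `{κ_n^Heeg}` is
non-zero; **Corollary 1**, rank-one case (p. 4 of the arXiv text):
"`corank_{ℤ_p} Sel_{p^∞}(E/K) = 1 ⟹ ord_{s=1} L(E/K,s) = 1`" (unconditional for `p > 3` under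
(irr)).

The statement below is that display in the case "`p > 3` satisfies (irr)", in the tree's
vocabulary (`analyticRankEK W K` = `ord_{s=1} L(E,s)L(E^{(d_K)},s)`, module docstring of
`BSDHeegnerPoints`; `SatisfiesHeegnerHypothesis p K` = "`p` splits in `K`").  It is, character
for character, the hypothesis `hBCGS` shared by the two ACCEPTED reductions
`burungaleTian_analyticRank_eq_one_of_selmerCorank_eq_one_of_hasCM_of_bcgs`
(`BSDSelmerCMPConverseHeegnerFieldProofs.lean`) and
`yanZhu_analyticRank_eq_one_of_selmerCorank_eq_one_of_bcgs` (`BSDSelmerPConverseYanZhuProofs.lean`),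
vendored as a named fact at the request of promote events 4473676 / 4366778 (provefact units of
Burungale–Tian 2020 Thm. 1.2 and Yan–Zhu Cor. 1.4; librarian sweep g40, 2026-08-17): with it,
both named facts are one line each modulo the existing facts `p_parity`,
`ModularForms.exists_isNewformOf`, `HoffsteinLuo1997_exists_twist_L_one_ne_zero`,
`kato_finite_of_L_one_ne_zero`.  Companion of the (sur)+(ram) `K`-level leaf
`burungaleSkinnerTianWan_analyticRankEK_eq_one_of_selmerCorank_eq_one` (`BSDSelmerPConverse`).
Deliberately NOT here: Kolyvagin systems, anticyclotomic Iwasawa theory, any proof.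

## References

* A. Burungale, F. Castella, G. Grossi, C. Skinner, *Non-vanishing of Kolyvagin systems and
  Iwasawa theory*, Camb. J. Math. 14 (2026), no. 2, 285–348; arXiv:2312.09301, §0.1, Thm. 1 and
  Cor. 1 (pp. 3–4). [BurungaleEtAl2026]
* A. Burungale, F. Castella, C. Skinner, *Base change and Iwasawa main conjectures for GL₂*,
  IMRN 2025, no. 8, Thm. 1.2.2 (a). [BurungaleCastellaSkinner2025]
-/

noncomputable section

-- `Classical` is scoped-open exactly as in `BSDSelmerPConverse` and the two consumer files: the
-- `AddCommGroup` instance on `(W.baseChange K).toAffine.Point` inside (tor) needs `DecidableEq K`.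
open scoped Classical

open WeierstrassCurve

namespace Literature.NumberTheory.EllipticCurves

/-- **Burungale–Castella–Grossi–Skinner 2026, Thm. 1 + Cor. 1 (rank-one case), under (irr).**
For every elliptic curve `E/ℚ` (globally minimal model `W`) and every prime `p > 3` of good
ordinary reduction (`W.HasGoodReductionAtPrime p`, `p ∤ a_p`) with `E[p]` irreducible (irr), and
every imaginary quadratic field `K` with (Heeg) every prime of the conductor split in `K`,
(disc) `d_K` odd and `d_K ≠ -3`, (tor) `E(K)[p] = 0`, and `p` split in `K`:
`corank_{ℤ_p} Sel_{p^∞}(E/K) = 1 ⟹ ord_{s=1} L(E/K, s) = 1` (`analyticRankEK W K = 1`).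
As printed (Thm. 1, "in particular" clause: unconditional when "`p > 3` satisfies (irr)", the
Iwasawa-theoretic input being Burungale–Castella–Skinner, Thm. 1.2.2 (a); Cor. 1): "In the rank
one case it yields a `p`-converse to the Gross–Zagier and Kolyvagin theorem:
`corank_{ℤ_p} Sel_{p^∞}(E/K) = 1 ⟹ ord_{s=1} L(E/K,s) = 1`".  A published THEOREM, not a
hypothesis.  Verbatim the hypothesis `hBCGS` of
`yanZhu_analyticRank_eq_one_of_selmerCorank_eq_one_of_bcgs` and of
`burungaleTian_analyticRank_eq_one_of_selmerCorank_eq_one_of_hasCM_of_bcgs`.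
[cite: BurungaleEtAl2026, Thm. 1 and Cor. 1 (rank-one case; arXiv:2312.09301, §0.1, pp. 3–4)]
[cite: BurungaleCastellaSkinner2025, Thm. 1.2.2 (a)] -/
def burungaleCastellaGrossiSkinner_analyticRankEK_eq_one_of_selmerCorank_eq_one : Prop :=
  ∀ (W : WeierstrassCurve ℚ) [W.IsElliptic] [W.IsGloballyMinimal] (p : ℕ) [Fact p.Prime],
    3 < p → W.HasGoodReductionAtPrime p → ¬ (p : ℤ) ∣ W.frobeniusTrace p →
    W.HasIrreducibleModPGaloisRep p →
    ∀ (K : Type) [Field K] [NumberField K], IsImaginaryQuadratic K →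
      SatisfiesHeegnerHypothesis (W.conductorNorm ℤ) K →
      Odd (NumberField.discr K) → NumberField.discr K ≠ -3 →
      AddSubgroup.torsionBy (W.baseChange K).toAffine.Point (p : ℤ) = ⊥ →
      SatisfiesHeegnerHypothesis p K →
      (W.baseChange K).selmerCorank p = 1 → analyticRankEK W K = 1

end Literature.NumberTheory.EllipticCurves

end
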